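import Summits.QuantumFields.YangMills.Theorems.BalabanUVNodesN07SplitClauseHeadKnitMeetNormalisedTowerW152E
import Summits.QuantumFields.YangMills.Theorems.BalabanUVNodesN07SplitClauseLevelRaisingMarginWideB
import Summits.QuantumFields.YangMills.Theorems.BalabanUVNodesN07LocalLettersCoreGuardedDatumB
import Literature.MathematicalPhysics.QuantumFieldTheory.Balaban1983to89.Node00.CriticalOnFibreB
import HarnessLib

/-!
# N07 [B11] (= [15] = [Balaban1985Variational]) Sect. F, S6 HEAD — MODULE 77c⁵ AT PRINT's [II] (2.3) DATUM, OVER A TOP-DATA PREDICATE, **WITHOUT THE SEAM** (S1c of the (E1)∕(iii-b) work plan,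
# director-ym №338∕№339; FLAG №16; LOCATE-HSEAM 5d3298b8d191f169): the meet knit `…TowerW152E` with (i) the data row of HS3NORM-152 ∕ HCHART-MEET-NORM-152 `Dat K s.Ω (suppDom) k δ W`
# (`Dat : TopData F N` arbitrary), (ii) their fibre rows `AgreeOnB (lamDatum F K k s.Ω) (Ū U) W → IsCritOnFibreB F N K (lamDatum F K k s.Ω) W U` (F0c ∕ F0b; print's datum), (iii) the
# conclusion dag-n07-w3's `DatumGaugeSplitTopStepCoreGB F N suppDom Mc ρ Adm (lamDatum F) Dat …`, and (iv) 77c⁵'s displayed HSEAM binder ABSENT — its content is DERIVED from the rows (ii)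

Cell `pub-ymgap`, seat `pub-ymgap-dag-n07-e` g34 (FAN-OUT §N07 row s3; LANE OWNER of the K0 road chart side).  `--kind proof --supports stmt-QuantumFields-20541 --as helper` (K0⁷); count-neutral;
def-free; ONE theorem.  PRINT-DATUM TWIN of `…N07SplitClauseHeadKnitMeetNormalisedTowerW152E.datumGaugeSplitTopStepCoreG_of_normalisedGauge_of_chartMeetTowerW152E` (FLAG №16 ∕ LOCATE-HSEAM
5d3298b8d191f169); the (b)-instance stays landed and true on its own text (a conditional displaying the extra hypothesis HSEAM; cf. dag-n07-w3's `not_hseam` ✓p765776 on the HSEAM binder of ✓140: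
an implication with an uninhabited hypothesis is vacuously true, not false).  HONESTY GUARD №338 (5): no displayed premise is deleted or weakened OTHER THAN the HSEAM binder, which the datum change makes
definitionally redundant — at `bd := lamDatum F` the two fibre rows that every binder already displays ARE, unfolded, the agreement on the (2.3) cells and print's cell-form criticality there
(F0b `mem_lamBondsSeq_iff_lamBond` ∕ `isCritOnFibreB_lamBondsSeq_iff`, hypotheses: standing range, `1 ≤ k`, nesting, block saturation — all in hand at the record); HS3NORM-152 and
HCHART-MEET-NORM-152 keep every row (three of them re-spelled over `(lamDatum F, Dat)`), HLETTERS-NORM ∕ HBUDGET-NORM ∕ `Nrm` ∕ all structural letters byte-identical.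
[15] = [Balaban1985Variational]; [6] = [Balaban1985RegularSpaces]; [4] = [II] = [Balaban1984PropagatorsII]; [III] = [Balaban1988Convergent]; [I] = [Balaban1987RG1].

WHY (LOCATE-HSEAM (γ), ruling (α)).  77c⁵ knits HS3NORM (the normalised Landau gauge at every meeting clean datum) with HCHART (print's (154)–(159) rows at the datum) into dag-n07-w4's per-datum
token; HCHART's (d′)-Lam supplier (MODULE 117′) needs the record's minimiser to be PRINT-critical in cell form on [II] (2.3)'s cells «Λ_j = Ω_j^{(j)} ∖ Ω_{j+1}^{(j)} … for the sets of sites and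
the sets of bonds» (p. 224; the DIFFERENCE of the bond sets — inward connectors belong to no `Λ_j`), which under reading (b)'s fibre `IsCritOnFibre … (genSet s.Ω k)` is a genuinely extra
hypothesis (HSEAM; uninhabited as displayed, ✓p765776).  At print's datum the token's OWN fibre rows are `AgreeOnB (lamBondsSeq s.Ω k)` ∕ `IsCritOnFibreB … (lamBondsSeq s.Ω k)` (`lamDatum_apply`),
and F0b's dictionary turns them into exactly HCHART's `hUW ∕ hcc` rows — so the knit closes with NO seam.  The rest of the proof (MODULE 66's margin reduction in dag-n07-w3's `(bd, Dat)` edition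
`datumGaugeSplitTopStepCoreGB_of_marginCleanPrint`, the datum numerics, FILE D0, 77a's `localGaugeSplitOn_head159_meetCube_box_farW` at zero shear) is 77c⁵'s verbatim.

WHAT IS PROVED (sorry-free; no definition; axioms standard).  ★★★ `datumGaugeSplitTopStepCoreGB_of_normalisedGauge_of_chartMeetTowerW152EB (F N)` — 77c⁵'s statement with `∀ (Dat : TopData F N)`
after the constants, changes (i)–(iv) above; proof = 77c⁵'s with `hseam`'s call replaced by the two dictionary lines.
HONEST SCOPE.  HS3NORM-152, HCHART-MEET-NORM-152, HLETTERS-NORM, HBUDGET-NORM are HYPOTHESES — displayed, NOT discharged here (their (2.3)-datum suppliers: S1c-1 ✓p765894 door from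
`HThm4RecSym152PhiEG` (CONDITIONAL), 89⁵′ p766239, 117′ᴮ, the print-datum near-row reader); nothing of [15]∕[6]∕[4] ANALYSIS asserted; NO stub registered or closed; K0⁷ ∕ K1⁹ NOT closed;
N07 NOT discharged; counts unmoved (typed 28∕28 · discharged 8∕28); one finite 𝕋⁴ programme at fixed ε — the route closes the conditional finite-𝕋⁴ rung `BalabanLadder.UV` ONLY; the YM
mass gap (Clay) is NOT proved by any of this; nothing continuum ∕ ℝ⁴ ∕ OS.  No `sorry`, no `def`, no `instance`, no `notation`.

References: [15] (144) p. 300, (147)–(156) pp. 301–302, (157)–(159) pp. 302–303, (160)–(166) pp. 303–304, (168) p. 304, Prop. 8 p. 304; [6] Thm. 2 p. 83, p. 98, Prop. 6 (1.135)–(1.138)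
p. 99, (1.29) p. 81, (1.3)–(1.9) p. 77, (1.131) p. 99; [II] (2.1)–(2.4) p. 224, Cor. 2.8 p. 249; [III] (2.2) p. 255, (2.10) p. 256; [I] (0.1) p. 251.
-/

set_option autoImplicit false

noncomputable section
open scoped BigOperators Matrix.Norms.L2Operator

namespace Summit.QuantumFields.YangMills.BalabanUVNodes.N07SplitClauseHeadKnitMeetNormalisedTowerW152EB

open Literature.MathematicalPhysics.QuantumFieldTheory.Balaban1983to89
open Literature.MathematicalPhysics.QuantumFieldTheory.Balaban1983to89.Node00
open Literature.MathematicalPhysics.QuantumFieldTheory.Balaban1983to89.B15DeterminingSets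
open Literature.MathematicalPhysics.QuantumFieldTheory.Balaban1983to89.B15DeterminingSetsB
open Literature.MathematicalPhysics.QuantumFieldTheory.Balaban1983to89.B12RegularSpaces111 (gaugeU expI grad)
open B15Eq112TorusCover (cover)
open B14DomainGeom (Pt Within)
open B14.Eq213MaximalDomains (side cubeExt)
open B5Eq117TorusCarriers (Mk)
open B5Eq118OneStroke (iterBlockOf)
open B5Prop12FieldsLattice (distSite)
open B8Eq131Cubes (sqLo sqHi box cube)
open B8LeafModelZd (ZdIdx)
open B11Eq115Space (levOf)
open B6SectADomainsV1 (Domains)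
open B6SectAOperatorsV1 (BondIdx RE dsE QpE)
open Literature.MathematicalPhysics.QuantumFieldTheory.BalabanImbrieJaffe1984to88.BIJ85AxialPropagator411 (BondSpace)
open T4Continuum (T4Family)
open T4AxialGaugeSmallField (castSite)
open B16Sect1Backgrounds (toMS)
open GaugeField (gaugeAct)
open MatrixLog (mlog)
open Summit.QuantumFields.YangMills.Theorems.K0FlatCubeOpsTextP (flatH)
open Summit.QuantumFields.YangMills.BalabanUVNodes.N07HalvingStepTopOfLocalLetters (Letters10On)
open Summit.QuantumFields.YangMills.BalabanUVNodes.N07LocalLettersSplitCore (LocalGaugeSplitOn)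
open Summit.QuantumFields.YangMills.BalabanUVNodes.N07LocalLettersCoreGuardedB (DatumGaugeSplitTopStepCoreGB)
open Summit.QuantumFields.YangMills.BalabanUVNodes.N07SplitClauseHeadAtMeetCubeFarW (localGaugeSplitOn_head159_meetCube_box_farW)
open Summit.QuantumFields.YangMills.BalabanUVNodes.N07MeetFamilyAtRecord (adm22_meetCube_trunc_seqOfRecord cover_mem_Ω_pred_of_meet_box)
open Summit.QuantumFields.YangMills.BalabanUVNodes.N07RecordDomainsAdm22 (blockSat_seqOfRecord)
open Summit.QuantumFields.YangMills.BalabanUVNodes.N07DatumGauge152Guarded (numerics_cornerP_of_levelGuard)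
open Summit.QuantumFields.YangMills.BalabanUVNodes.N07SplitClauseLevelRaisingMarginWideB (datumGaugeSplitTopStepCoreGB_of_marginCleanPrint)
open Summit.QuantumFields.YangMills.BalabanUVNodes.N07SplitClauseHeadKnitMeetNormalised (grad_zero_fun split159_of_zero_shear)
open Summit.QuantumFields.YangMills.BalabanUVNodes.N07ShearSizeTopBox (dist1_iter_avOfRecord_gaugeAct_one dist1_iter_avOfRecord_one)

/-! ## §1  The knit under the normalised gauge -/

open scoped Classical in
/-- ★★★ **THE MEET KNIT UNDER PRINT's NORMALISED LANDAU GAUGE, (152)-COMPLETE TOWER EDITION, AT PRINT's [II] (2.3) DATUM `bd := lamDatum F` AND ANY TOP-DATA PREDICATE `Dat` — NO SEAM**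
(print-datum twin of `datumGaugeSplitTopStepCoreG_of_normalisedGauge_of_chartMeetTowerW152E` (FLAG №16 ∕ LOCATE-HSEAM 5d3298b8d191f169); the (b)-instance stays landed and true on its own
text): the guarded per-datum token `DatumGaugeSplitTopStepCoreGB F N suppDom Mc ρ Adm (lamDatum F) Dat B₃ C θ Q κ a₀ a₁` (dag-n07-w3's S1c-0) for every guard `Adm` implying the V20-G conjuncts
and the run's grid numerics, every letter `κ ≥ 0`, every normalisation predicate `Nrm` and EVERY `Dat : TopData F N`, modulo the displayed HS3NORM-152, HCHART-MEET-NORM-152, HLETTERS-NORM and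
HBUDGET-NORM — whose data row is `Dat K s.Ω (suppDom) k δ W` and whose fibre rows are `AgreeOnB (lamDatum F K k s.Ω) (Ū U) W → IsCritOnFibreB F N K (lamDatum F K k s.Ω) W U`.  77c⁵'s HSEAM
binder is ABSENT: at the (2.3) datum its content (agreement on the `LamBond` cells of `domainsOfSeq s.Ω k` and print's cell-form criticality there — what HCHART's `hUW ∕ hcc` rows ask) IS the
two fibre rows unfolded (F0b `mem_lamBondsSeq_iff_lamBond`, `isCritOnFibreB_lamBondsSeq_iff`; nesting from `s.chain`, block saturation from the guard's grid numerics), so it is DERIVED in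
the proof where 77c⁵ invoked `hseam`.  Everything else = 77c⁵ byte for byte.
[cite: Balaban1985Variational, (144) p.300, (147)–(156) pp.301–302, (157)–(159) pp.302–303, (160)–(166) pp.303–304, (168) p.304, Prop. 8 p.304; Balaban1985RegularSpaces, Thm. 2 p.83, (1.29) p.81, p.98 (□̃, □_j), Prop. 6 (1.135)–(1.138) p.99, (1.131) p.99; Balaban1984PropagatorsII, (2.1)–(2.4) p.224, Cor. 2.8 (2.150)–(2.151) p.249; Balaban1988Convergent, (2.10) p.256] -/
theorem datumGaugeSplitTopStepCoreGB_of_normalisedGauge_of_chartMeetTowerW152EB (F : T4Family) (N : ℕ) [NeZero N] :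
    ∃ (Mh₀ R₀ : ℕ) (CH δH BH : ℝ), 0 ≤ CH ∧ 0 < δH ∧ 0 < BH ∧
    ∀ (Dat : TopData F N) {ρ : ℕ}
      -- structural letters: grid cube `Mc`, block height `a′` (`M_h = L^{a′} ≥ M_h⁰`), `R ≥ R₀`, the collar `ρ` with `L·M_h ∣ ρ`, `R·L·M_h ≤ ρ`, `L ≤ ρ`
      {Mc Mh R a' : ℕ} (_ : 1 ≤ Mc) (_ : Mc ≤ ρ) (_ : Mh = F.L ^ a') (_ : Mh₀ ≤ Mh) (_ : R₀ ≤ R) (_ : F.L * Mh ∣ ρ) (_ : R * (F.L * Mh) ≤ ρ) (hLρ : F.L ≤ ρ)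
      -- the two constants of the plan's V20-G guard `c ≤ ν.M₁ ∧ k + c₀ ≤ F.m + K` and their side conditions (as in FILE D)
      {c c₀ : ℕ} (_ : (11 * 4 + 4 * ρ + Mc + 3) * F.L ≤ c) (_ : Mc + 11 * 4 + 6 * ρ ≤ 2 * F.L ^ c₀) (_ : F.m ≤ c₀) (_ : a' + 3 ≤ c₀)
      -- ★ THE GUARD: any step guard implying the V20-G conjuncts AND the run's grid numerics the meet's (2.1) needs (`hgran`, `hdiv`)
      (Adm : StepGuard F) (_ : ∀ (ν : Stage7Numerics) (M : ℕ) (g : ℕ → ℝ) (K k : ℕ) (s : SeqOfRecord F ν M g K k), Adm ν M g K k s → c ≤ ν.M₁ ∧ k + c₀ ≤ F.m + K)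
      (_ : ∀ (ν : Stage7Numerics) (M : ℕ) (g : ℕ → ℝ) (K k : ℕ) (s : SeqOfRecord F ν M g K k), Adm ν M g K k s → ∀ j : ℕ, 1 ≤ j → j ≤ k →
        F.L * Mh ∣ M * RkOfRecord (F.P K).L ν.r (g j) ∧ dCubeSide (F.P K).L M (RkOfRecord (F.P K).L ν.r (g j)) j ∣ (F.P K).sitesPerDir 0)
      -- the token's letters, `0 < B₃`, the FREE (152)-letter `κ ≥ 0`, the (163)-type letter `θ_H` of the `H` doors
      {B₃ C θ Q κ a₀ a₁ θH : ℝ} (_ : 0 < B₃) (_ : 0 ≤ C) (_ : 0 ≤ θ) (_ : 0 ≤ Q) (_ : 0 ≤ κ) (_ : 8 * CH * BH * Real.exp (-(δH * (ρ : ℝ))) ≤ θH)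
      -- the chart side's PER-LEVEL SIZE LETTERS, functions of the letters `(ε, δ)` and the level only — NO shear letters `σ ∕ v ∕ av`
      (β₁ β₂ s' t₁ : (ℕ → ℝ) → (ℕ → ℝ) → ℕ → ℝ)
      -- ★ HLETTERS-NORM (RANGED): signs only, IN THE TOKEN's RANGE `0 < δ_j ≤ a₁`, `B₃δ_j ≤ ε_j ≤ a₀`
      (_ : ∀ (ε δ : ℕ → ℝ) (j : ℕ), 0 < δ j → δ j ≤ a₁ → B₃ * δ j ≤ ε j → ε j ≤ a₀ → 0 ≤ β₁ ε δ j ∧ 0 ≤ β₂ ε δ j ∧ 0 ≤ s' ε δ j)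
      -- ★ HBUDGET-NORM (RANGED): thresholds above FILE C's two floors summing STRICTLY below the token's threshold — no `t_D`, no `C_S·B_S`
      (_ : ∀ (K : ℕ) (ε δ : ℕ → ℝ) (j : ℕ), 0 < δ j → δ j ≤ a₁ → B₃ * δ j ≤ ε j → ε j ≤ a₀ → ∃ t₂ t₃ : ℝ,
        1 / 4 * ((sideP (F.P K) Mc ρ : ℕ) : ℝ) * max (4 * CH * BH * β₁ ε δ j) (θH * β₂ ε δ j) < t₂ ∧ 2 * CH * BH * s' ε δ j < t₃ ∧
        t₁ ε δ j + t₂ + t₃ < C * δ j + θ * ε j + Q * ε j ^ 2)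
      -- ★ THE NORMALISATION PREDICATE (abstract): print's «`ū_j = 1` on `Λ′_j`» in the record currency the S3 pens and the chart lane agree
      (Nrm : ∀ (ν : Stage7Numerics) (M : ℕ) (g : ℕ → ℝ) (K k : ℕ), SeqOfRecord F ν M g K k → (ℕ → ℝ) → GaugeField (F.P K) 0 (SU N) → ℕ → Pt (F.P K).d →
        GaugeTransf (F.P K) 0 (SU N) → (PBond (F.P K) 0 → MatA N) → Prop)
      -- ★ HS3NORM-67c: [6] Thm. 2's NORMALISED local Landau gauge at every MEETING, PRINT-MARGIN-CLEAN datum — (152) on the whole TOWER (gauge equation on `□₀`, level-weighted letters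
      --   `< κ·ε_j·L^{j−j′}` on `□_{j′}`), the print-box letters `< κ·ε_j`, (153) for the MEET sequence, and `Nrm`
      (_ : ∀ (ν : Stage7Numerics) (M : ℕ) (g : ℕ → ℝ) (K k : ℕ) (s : SeqOfRecord F ν M g K k), Sect2.SeqSeparated ν.M₁ s → 0 < ν.M₁ →
        Adm ν M g K k s → 1 ≤ k →
        ∀ (ε δ : ℕ → ℝ),
        (∀ n, n ≤ k → 0 < δ n ∧ δ n ≤ a₁) → (∀ n, n < k → δ n ≤ 2 * δ (n + 1)) → (∀ n, n < k → δ (n + 1) ≤ 2 * δ n) →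
        (∀ n, n ≤ k → B₃ * δ n ≤ ε n ∧ ε n ≤ a₀) → (∀ n, n < k → ε n ≤ 2 * ε (n + 1)) → (∀ n, n < k → ε (n + 1) ≤ 2 * ε n) →
        ∀ W : MSField (F.P K) (SU N), Dat K s.Ω (suppDomOfRecord F ν K s.Ω) k δ W →
        ∀ U : GaugeField (F.P K) 0 (SU N),
        (∀ n, n ≤ k → PlaqSmallOn (Sect2.omegaPlaqsTop s.Ω (suppDomOfRecord F ν K s.Ω) n) (ε n * (F.P K).eta n ^ 2) U) →
        (∀ n, n ≤ k → Sect2.CoDivSmallOn (Sect2.omegaBondsTop s.Ω (suppDomOfRecord F ν K s.Ω) n) (ε n * (F.P K).eta n ^ 3) U) →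
        AgreeOnB (lamDatum F K k s.Ω) (avgFamily (avOfRecord F N K) U) W → IsCritOnFibreB F N K (lamDatum F K k s.Ω) W U →
        ∀ (n : ℕ) (hk : K - n ≤ (F.P K).m + (F.P K).K), 1 ≤ K - n → K - n ≤ k → ∀ (idx : Pt (F.P K).d),
        (∃ x ∈ box (F.P K).L (cornerP (F.P K) Mc ρ idx) (sideP (F.P K) Mc ρ) (K - n), ∃ y : Pt (F.P K).d, cover (F.P K) y ∈ s.Ω (K - n) ∧ Within ((3 : ℕ) : ℤ) x y) →
        (K - n = k ∨ ∀ z ∈ box (F.P K).L (cornerP (F.P K) Mc ρ idx - ((2 * ρ : ℕ) : Pt (F.P K).d)) (sideP (F.P K) Mc ρ + 2 * (2 * ρ)) (K - n),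
          cover (F.P K) z ∉ s.Ω (K - n + 1)) →
        ∃ (u : GaugeTransf (F.P K) 0 (SU N)) (A : PBond (F.P K) 0 → MatA N),
        (∀ b ∈ (Sect2.regionOfSet (F.P K) (cover (F.P K) '' box (F.P K).L (cornerP (F.P K) Mc ρ idx) (sideP (F.P K) Mc ρ) (K - n))).bonds,
          gaugeU (fun x => ιSU N (u x)) (fun b' => ιSU N (U b')) b = expI ((F.P K).eta (K - n)) (A b)) ∧
        -- (T1) the gauge equation on the WHOLE TOWER `□₀` of the datum ([6] p. 98, (1.131))
        (∀ b ∈ (Sect2.regionOfSet (F.P K) (cover (F.P K) '' cube (F.P K).L (cornerP (F.P K) Mc ρ idx) (sideP (F.P K) Mc ρ) ρ (K - n) 0)).bonds,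
          gaugeU (fun x => ιSU N (u x)) (fun b' => ιSU N (U b')) b = expI ((F.P K).eta (K - n)) (A b)) ∧
        -- (T2) (152)'s LEVEL-WEIGHTED letters on every `□_{j′}`, `j′ ≤ K − n`
        (∀ j', j' ≤ K - n →
          ∀ b ∈ (Sect2.regionOfSet (F.P K) (cover (F.P K) '' cube (F.P K).L (cornerP (F.P K) Mc ρ idx) (sideP (F.P K) Mc ρ) ρ (K - n) j')).bonds,
            ‖A b‖ < κ * ε (K - n) * ((F.P K).L : ℝ) ^ (K - n - j')) ∧
        (∀ j', j' ≤ K - n →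
          ∀ q ∈ (Sect2.regionOfSet (F.P K) (cover (F.P K) '' cube (F.P K).L (cornerP (F.P K) Mc ρ idx) (sideP (F.P K) Mc ρ) ρ (K - n) j')).dpairs,
            ‖grad ((F.P K).eta (K - n)) q.2.1 (fun y => A ⟨y, q.2.2⟩) q.1‖ < κ * ε (K - n) * ((F.P K).L : ℝ) ^ (2 * (K - n - j'))) ∧
        (∀ b ∈ (Sect2.regionOfSet (F.P K) (cover (F.P K) '' box (F.P K).L (cornerP (F.P K) Mc ρ idx) (sideP (F.P K) Mc ρ) (K - n))).bonds,
          ‖A b‖ < κ * ε (K - n)) ∧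
        (∀ q ∈ (Sect2.regionOfSet (F.P K) (cover (F.P K) '' box (F.P K).L (cornerP (F.P K) Mc ρ idx) (sideP (F.P K) Mc ρ) (K - n))).dpairs,
          ‖grad ((F.P K).eta (K - n)) q.2.1 (fun y => A ⟨y, q.2.2⟩) q.1‖ < κ * ε (K - n)) ∧
        (∀ b ∈ Sect2.bondsDeep (cover (F.P K) '' box (F.P K).L (cornerP (F.P K) Mc ρ idx) (sideP (F.P K) Mc ρ) (K - n)),
          ‖Sect2.codiffCurlA ((F.P K).eta (K - n)) A b.src b.dir‖ < κ * ε (K - n)) ∧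
        (∀ b ∈ Sect2.bondsDeep (cover (F.P K) '' box (F.P K).L (cornerP (F.P K) Mc ρ idx) (sideP (F.P K) Mc ρ) (K - n)),
          ‖∑ ν' : Fin (F.P K).d, (((F.P K).eta (K - n) : ℝ) : ℂ)⁻¹ •
              (grad ((F.P K).eta (K - n)) ν' (fun y => A ⟨y, b.dir⟩) (b.src.unshift ν') - grad ((F.P K).eta (K - n)) ν' (fun y => A ⟨y, b.dir⟩) b.src)‖ <
            κ * ε (K - n)) ∧
        (∀ D' : Domains (F.P K), LinearMap.ker (QpE D') ≤
            LinearMap.ker (QpE (domainsMeet (cubeDomains (F.P K) (cornerP (F.P K) Mc ρ idx) (sideP (F.P K) Mc ρ) ρ (K - n) hk) (domainsOfSeq s.Ω (K - n) hk))) →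
          ∀ φ : MatA N →L[ℂ] ℂ,
          RE D' ((F.P K).eta (K - n))⁻¹ (dsE ((F.P K).eta (K - n))⁻¹ (WithLp.toLp 2 fun b => (φ (A b)).re : BondSpace (F.P K))) = 0 ∧
          RE D' ((F.P K).eta (K - n))⁻¹ (dsE ((F.P K).eta (K - n))⁻¹ (WithLp.toLp 2 fun b => (φ (A b)).im : BondSpace (F.P K))) = 0) ∧
        Nrm ν M g K k s ε U (K - n) idx u A)
      -- ★ HCHART-MEET-NORM-67c: the chart lane's per-datum deliverable at PRINT's (150) FAMILY `D″` UNDER THE NORMALISED GAUGE — print's (154)–(159), shear-free — now GIVEN (152) on the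
      --   whole tower ((T1) gauge equation on `□₀`, (T2) level-weighted letters on every `□_{j′}`): the FAR row is LEVEL-WEIGHTED (print (152) with (156)–(157)) — free from (T2) (`B c := Q_c(A)`, MODULE 78)
      (_ : ∀ (ν : Stage7Numerics) (M : ℕ) (g : ℕ → ℝ) (K k : ℕ) (s : SeqOfRecord F ν M g K k), Sect2.SeqSeparated ν.M₁ s → 0 < ν.M₁ →
        Adm ν M g K k s → 1 ≤ k →
        ∀ (ε δ : ℕ → ℝ),
        (∀ n, n ≤ k → 0 < δ n ∧ δ n ≤ a₁) → (∀ n, n < k → δ n ≤ 2 * δ (n + 1)) → (∀ n, n < k → δ (n + 1) ≤ 2 * δ n) →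
        (∀ n, n ≤ k → B₃ * δ n ≤ ε n ∧ ε n ≤ a₀) → (∀ n, n < k → ε n ≤ 2 * ε (n + 1)) → (∀ n, n < k → ε (n + 1) ≤ 2 * ε n) →
        ∀ W : MSField (F.P K) (SU N), Dat K s.Ω (suppDomOfRecord F ν K s.Ω) k δ W →
        ∀ U : GaugeField (F.P K) 0 (SU N),
        (∀ n, n ≤ k → PlaqSmallOn (Sect2.omegaPlaqsTop s.Ω (suppDomOfRecord F ν K s.Ω) n) (ε n * (F.P K).eta n ^ 2) U) →
        (∀ n, n ≤ k → Sect2.CoDivSmallOn (Sect2.omegaBondsTop s.Ω (suppDomOfRecord F ν K s.Ω) n) (ε n * (F.P K).eta n ^ 3) U) →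
        AgreeOnB (lamDatum F K k s.Ω) (avgFamily (avOfRecord F N K) U) W → IsCritOnFibreB F N K (lamDatum F K k s.Ω) W U →
        -- ★ the (2.3) CELLS of the record's family: the data there and PRINT's CELL-FORM CRITICALITY (the fibre rows above, unfolded by F0b's dictionary)
        ∀ (hkk : k ≤ (F.P K).m + (F.P K).K),
        (∀ (j : ℕ) (c : PBond (F.P K) j), (domainsOfSeq s.Ω k hkk).LamBond j c → avgFamily (avOfRecord F N K) U j c = W j c) →
        (∀ γ : ℝ → GaugeField (F.P K) 0 (SU N), γ 0 = U →
          DifferentiableAt ℝ (fun (t : ℝ) (b : PBond (F.P K) 0) => ((γ t b : SU N) : Matrix (Fin N) (Fin N) ℂ)) 0 →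
            (∀ᶠ t in nhds (0 : ℝ), ∀ (j : ℕ) (c : PBond (F.P K) j), (domainsOfSeq s.Ω k hkk).LamBond j c →
              avgFamily (avOfRecord F N K) (γ t) j c = W j c) →
              ∀ a : ℝ, HasDerivAt (fun t => wilsonAction4 (γ t)) a 0 → a = 0) →
        ∀ (n : ℕ) (hk : K - n ≤ (F.P K).m + (F.P K).K), 1 ≤ K - n → K - n ≤ k → ∀ (idx : Pt (F.P K).d),
        -- MEETING DATUMS ONLY: the print box has a point within `3` of a lift of a site of `Ω_{K−n}`
        (∃ x ∈ box (F.P K).L (cornerP (F.P K) Mc ρ idx) (sideP (F.P K) Mc ρ) (K - n), ∃ y : Pt (F.P K).d, cover (F.P K) y ∈ s.Ω (K - n) ∧ Within ((3 : ℕ) : ℤ) x y) →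
        -- PRINT-MARGIN-CLEAN DATUMS ONLY (print p. 300 + (144)'s margin cube «□̃» = the print box WIDENED BY `2ρ` BLOCKS): top level, or «□̃» misses `Ω_{j+1}`
        (K - n = k ∨ ∀ z ∈ box (F.P K).L (cornerP (F.P K) Mc ρ idx - ((2 * ρ : ℕ) : Pt (F.P K).d)) (sideP (F.P K) Mc ρ + 2 * (2 * ρ)) (K - n),
          cover (F.P K) z ∉ s.Ω (K - n + 1)) →
        -- THE FAMILY: print's (150) `Ω′_j = □_j (j < k), Ω′_k = □_k ∩ Ω_k`
        ∀ {HVd : Domains (F.P K)}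
          (_ : HVd = domainsMeet (cubeDomains (F.P K) (cornerP (F.P K) Mc ρ idx) (sideP (F.P K) Mc ρ) ρ (K - n) hk) (domainsOfSeq s.Ω (K - n) hk))
          (lo hi : ℕ → Pt (F.P K).d),
        lo 0 = (fun i => ((F.P K).L : ℤ) * (sqLo (F.P K).L (cornerP (F.P K) Mc ρ idx) ρ (K - n) 1 i - 1)) →
        hi 0 = (fun i => ((F.P K).L : ℤ) * (sqHi (F.P K).L (cornerP (F.P K) Mc ρ idx) (sideP (F.P K) Mc ρ) ρ (K - n) 1 i + 1) + (((F.P K).L : ℤ) - 1)) →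
        (∀ j', 1 ≤ j' → lo j' = sqLo (F.P K).L (cornerP (F.P K) Mc ρ idx) ρ (K - n) j' - 1) →
        (∀ j', 1 ≤ j' → hi j' = sqHi (F.P K).L (cornerP (F.P K) Mc ρ idx) (sideP (F.P K) Mc ρ) ρ (K - n) j' + 1) →
        ∃ HV : (BondIdx HVd → MatA N) →ₗ[ℂ] (PBond (F.P K) 0 → MatA N),
          (∀ (Bf : BondIdx HVd → MatA N) (b : PBond (F.P K) 0), HV Bf b = ∑ c, ((flatH (F.P K) (K - n) HVd (Pi.single c 1) b : ℝ) : ℂ) • Bf c) ∧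
        ∀ (u : GaugeTransf (F.P K) 0 (SU N)) (A : PBond (F.P K) 0 → MatA N),
        (∀ b ∈ (Sect2.regionOfSet (F.P K) (cover (F.P K) '' box (F.P K).L (cornerP (F.P K) Mc ρ idx) (sideP (F.P K) Mc ρ) (K - n))).bonds,
          gaugeU (fun x => ιSU N (u x)) (fun b' => ιSU N (U b')) b = expI ((F.P K).eta (K - n)) (A b)) →
        -- (T1) the gauge equation on the WHOLE TOWER `□₀` of the datum
        (∀ b ∈ (Sect2.regionOfSet (F.P K) (cover (F.P K) '' cube (F.P K).L (cornerP (F.P K) Mc ρ idx) (sideP (F.P K) Mc ρ) ρ (K - n) 0)).bonds,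
          gaugeU (fun x => ιSU N (u x)) (fun b' => ιSU N (U b')) b = expI ((F.P K).eta (K - n)) (A b)) →
        -- (T2) (152)'s LEVEL-WEIGHTED letters on every `□_{j′}`, `j′ ≤ K − n`
        (∀ j', j' ≤ K - n →
          ∀ b ∈ (Sect2.regionOfSet (F.P K) (cover (F.P K) '' cube (F.P K).L (cornerP (F.P K) Mc ρ idx) (sideP (F.P K) Mc ρ) ρ (K - n) j')).bonds,
            ‖A b‖ < κ * ε (K - n) * ((F.P K).L : ℝ) ^ (K - n - j')) →
        (∀ j', j' ≤ K - n →
          ∀ q ∈ (Sect2.regionOfSet (F.P K) (cover (F.P K) '' cube (F.P K).L (cornerP (F.P K) Mc ρ idx) (sideP (F.P K) Mc ρ) ρ (K - n) j')).dpairs,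
            ‖grad ((F.P K).eta (K - n)) q.2.1 (fun y => A ⟨y, q.2.2⟩) q.1‖ < κ * ε (K - n) * ((F.P K).L : ℝ) ^ (2 * (K - n - j'))) →
        (∀ b ∈ (Sect2.regionOfSet (F.P K) (cover (F.P K) '' box (F.P K).L (cornerP (F.P K) Mc ρ idx) (sideP (F.P K) Mc ρ) (K - n))).bonds,
          ‖A b‖ < κ * ε (K - n)) →
        (∀ q ∈ (Sect2.regionOfSet (F.P K) (cover (F.P K) '' box (F.P K).L (cornerP (F.P K) Mc ρ idx) (sideP (F.P K) Mc ρ) (K - n))).dpairs,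
          ‖grad ((F.P K).eta (K - n)) q.2.1 (fun y => A ⟨y, q.2.2⟩) q.1‖ < κ * ε (K - n)) →
        (∀ b ∈ Sect2.bondsDeep (cover (F.P K) '' box (F.P K).L (cornerP (F.P K) Mc ρ idx) (sideP (F.P K) Mc ρ) (K - n)),
          ‖Sect2.codiffCurlA ((F.P K).eta (K - n)) A b.src b.dir‖ < κ * ε (K - n)) →
        (∀ b ∈ Sect2.bondsDeep (cover (F.P K) '' box (F.P K).L (cornerP (F.P K) Mc ρ idx) (sideP (F.P K) Mc ρ) (K - n)),
          ‖∑ ν' : Fin (F.P K).d, (((F.P K).eta (K - n) : ℝ) : ℂ)⁻¹ •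
              (grad ((F.P K).eta (K - n)) ν' (fun y => A ⟨y, b.dir⟩) (b.src.unshift ν') - grad ((F.P K).eta (K - n)) ν' (fun y => A ⟨y, b.dir⟩) b.src)‖ <
            κ * ε (K - n)) →
        (∀ D' : Domains (F.P K), LinearMap.ker (QpE D') ≤ LinearMap.ker (QpE HVd) → ∀ φ : MatA N →L[ℂ] ℂ,
          RE D' ((F.P K).eta (K - n))⁻¹ (dsE ((F.P K).eta (K - n))⁻¹ (WithLp.toLp 2 fun b => (φ (A b)).re : BondSpace (F.P K))) = 0 ∧
          RE D' ((F.P K).eta (K - n))⁻¹ (dsE ((F.P K).eta (K - n))⁻¹ (WithLp.toLp 2 fun b => (φ (A b)).im : BondSpace (F.P K))) = 0) →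
        -- ★ THE NORMALISATION of this `u` (print's «ū_j = 1 on Λ′_j»), as delivered by HS3NORM
        Nrm ν M g K k s ε U (K - n) idx u A →
        -- print's (154)–(159): the centre `x_c`, the DATA rows `B` ((160) near, centred; (152)∕(156)–(157) far, level-weighted), the small datum `B′`, the (158)∕(165) summand `A₁`, and `A = A₁ + H_V B − H_V B′`
        ∃ (xc : Pt (F.P K).d) (B B' : BondIdx HVd → MatA N) (A₁ : PBond (F.P K) 0 → MatA N),
          xc ∈ box (F.P K).L (cornerP (F.P K) Mc ρ idx) (sideP (F.P K) Mc ρ) (K - n) ∧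
          (∀ c : BondIdx HVd, ((c.1.1 : ℕ) = K - n ∨
              (blockOf c.1.2.src ∈ (cubeDomains (F.P K) (cornerP (F.P K) Mc ρ idx) (sideP (F.P K) Mc ρ) ρ (K - n) hk).Om ((c.1.1 : ℕ) + 1) ∧
                blockOf c.1.2.tgt ∈ (cubeDomains (F.P K) (cornerP (F.P K) Mc ρ idx) (sideP (F.P K) Mc ρ) ρ (K - n) hk).Om ((c.1.1 : ℕ) + 1))) →
            ‖B c‖ ≤ β₁ ε δ (K - n) * (distSite (Mk (F.P K) (c.1.1 : ℕ)) c.1.2.src (iterBlockOf (c.1.1 : ℕ) (cover (F.P K) xc)) + 1)) ∧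
          (∀ c : BondIdx HVd, ¬ ((c.1.1 : ℕ) = K - n ∨
              (blockOf c.1.2.src ∈ (cubeDomains (F.P K) (cornerP (F.P K) Mc ρ idx) (sideP (F.P K) Mc ρ) ρ (K - n) hk).Om ((c.1.1 : ℕ) + 1) ∧
                blockOf c.1.2.tgt ∈ (cubeDomains (F.P K) (cornerP (F.P K) Mc ρ idx) (sideP (F.P K) Mc ρ) ρ (K - n) hk).Om ((c.1.1 : ℕ) + 1))) →
            ‖B c‖ ≤ β₂ ε δ (K - n) * ((ρ : ℝ) + ((sideP (F.P K) Mc ρ : ℕ) : ℝ)) * ((F.P K).L : ℝ) ^ ((K - n) - (c.1.1 : ℕ))) ∧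
          (∀ c, ‖B' c‖ ≤ s' ε δ (K - n)) ∧
          Letters10On (cover (F.P K) '' box (F.P K).L (cornerP (F.P K) Mc ρ idx) (sideP (F.P K) Mc ρ) (K - n)) ((F.P K).eta (K - n)) (t₁ ε δ (K - n)) A₁ ∧
          (∀ b, A b = A₁ b + HV B b - HV B' b)),
      DatumGaugeSplitTopStepCoreGB F N (fun ν K Ω => suppDomOfRecord F ν K Ω) Mc ρ Adm (lamDatum F) Dat B₃ C θ Q κ a₀ a₁ := by
  obtain ⟨Mh₀, R₀, CS, BS, CH, δH, BH, -, -, hCH, hδH, hBH, hmain⟩ := localGaugeSplitOn_head159_meetCube_box_farW F N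
  refine ⟨Mh₀, R₀, CH, δH, BH, hCH, hδH, hBH, ?_⟩
  intro Dat ρ Mc Mh R a' hMc hMcρ hMha hMh hR hdvd hRρ hLρ c c₀ hc hc₀ hmc₀ hac₀ Adm hAdm₁ hAdm₂ B₃ C θ Q κ a₀ a₁ θH hB₃ hC0 hθ0 hQ0 hκ0 h163
    β₁ β₂ s' t₁ hletters hbudget Nrm hS3 hchart
  -- the width-generic margin level-raising reduction at PRINT's width `w = 2ρ` (MODULE 66): the clause is owed at PRINT-MARGIN-CLEAN datums whose print box MEETS `Ω_j`
  refine datumGaugeSplitTopStepCoreGB_of_marginCleanPrint F N hMc hMcρ hB₃.le hκ0 hC0 hθ0 hQ0 ?_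
  intro ν M g K k s hsep hM₁ hadm hk ε δ hδ hcompδ hcompδ' hε hεcomp hεcomp' W h7 U h17 h19 hfib hcrit j hj hjk a hmeet hclean
  -- the guard's two halves: the V20-G conjuncts and the run's grid numerics
  have hV20 : c ≤ ν.M₁ ∧ k + c₀ ≤ F.m + K := hAdm₁ ν M g K k s hadm
  have hgrid := hAdm₂ ν M g K k s hadm
  -- the level guard with `F.m ≤ c₀` puts every datum level below `K`: write it as `K − n`
  have hkK : k ≤ K := by have := hV20.2; omega
  obtain ⟨n, rfl⟩ : ∃ n, j = K - n := ⟨K - j, by omega⟩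
  have hk1 : 1 ≤ K - n := hj
  have hkP : K - n ≤ (F.P K).m + (F.P K).K := by
    have : (F.P K).m + (F.P K).K = F.m + K := rfl
    omega
  have hLρ' : (F.P K).L ≤ ρ := hLρ
  -- the letters' ranges at the datum's level
  have hr1 : 0 < δ (K - n) := (hδ _ hjk).1
  have hr2 : δ (K - n) ≤ a₁ := (hδ _ hjk).2
  have hr3 : B₃ * δ (K - n) ≤ ε (K - n) := (hε _ hjk).1
  have hr4 : ε (K - n) ≤ a₀ := (hε _ hjk).2
  obtain ⟨hβ₁, hβ₂, hs'⟩ := hletters ε δ (K - n) hr1 hr2 hr3 hr4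
  obtain ⟨t₂, t₃, ht₂, ht₃, hsum⟩ := hbudget K ε δ (K - n) hr1 hr2 hr3 hr4
  -- ★ S3's NORMALISED gauge at this meeting, clean datum (HS3NORM), and the datum's numerics from the level guard
  obtain ⟨u, A, he, heT, hAT, hAT2, hA, hdA, hcd, hlap, h6, hnrm⟩ := hS3 ν M g K k s hsep hM₁ hadm hk ε δ hδ hcompδ hcompδ' hε hεcomp hεcomp' W h7 U h17 h19
    hfib hcrit n hkP hk1 hjk a hmeet hclean
  -- the (2.3) cells of the record's family at this run: the fibre rows at `bd := lamDatum F`, unfolded by F0b's dictionary (nesting from the chain, saturation from the grid numerics)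
  have hkkP : k ≤ (F.P K).m + (F.P K).K := by have : (F.P K).m + (F.P K).K = F.m + K := rfl; omega
  have hnestk : ∀ i : ℕ, 1 ≤ i → i < k → s.Ω (i + 1) ⊆ s.Ω i := fun i h1 hi => s.chain.Ω_succ_subset_Ω h1 hi
  have hsatk : ∀ (j' : ℕ) (x x' : Site (F.P K) 0), 1 ≤ j' → j' ≤ k → iterBlockOf j' x = iterBlockOf j' x' → x ∈ s.Ω j' → x' ∈ s.Ω j' :=
    blockSat_seqOfRecord F ν M g K k hkkP s (fun i' h1' hi' => (hgrid i' h1' hi').2)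
  have hcc := (isCritOnFibreB_lamBondsSeq_iff (F := F) (N := N) hkkP hk hnestk hsatk W U).1 hcrit
  have hUW : ∀ (j' : ℕ) (c' : PBond (F.P K) j'), (domainsOfSeq s.Ω k hkkP).LamBond j' c' → avgFamily (avOfRecord F N K) U j' c' = W j' c' :=
    fun j' c' hc' => hfib j' c' ((mem_lamBondsSeq_iff_lamBond s.Ω hkkP hk hnestk hsatk j' c').2 hc')
  obtain ⟨ha, hM, hper, hinj⟩ := numerics_cornerP_of_levelGuard F hk1 hjk hV20.2 hMha (by omega) hLρ' hdvd hc₀ a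
  have hρpos : 0 < ρ := lt_of_lt_of_le (F.P K).L_pos hLρ'
  have hM1 : 1 ≤ sideP (F.P K) Mc ρ := by have := le_sideP (P := F.P K) Mc hρpos; omega
  -- the canonical boxes of the datum's tower
  set lo : ℕ → Pt (F.P K).d := fun j' => if j' = 0 then (fun i => ((F.P K).L : ℤ) * (sqLo (F.P K).L (cornerP (F.P K) Mc ρ a) ρ (K - n) 1 i - 1))
    else sqLo (F.P K).L (cornerP (F.P K) Mc ρ a) ρ (K - n) j' - 1 with hlo
  set hi : ℕ → Pt (F.P K).d := fun j' => if j' = 0 then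
      (fun i => ((F.P K).L : ℤ) * (sqHi (F.P K).L (cornerP (F.P K) Mc ρ a) (sideP (F.P K) Mc ρ) ρ (K - n) 1 i + 1) + (((F.P K).L : ℤ) - 1))
    else sqHi (F.P K).L (cornerP (F.P K) Mc ρ a) (sideP (F.P K) Mc ρ) ρ (K - n) j' + 1 with hhi
  have hlo0 : lo 0 = fun i => ((F.P K).L : ℤ) * (sqLo (F.P K).L (cornerP (F.P K) Mc ρ a) ρ (K - n) 1 i - 1) := by simp [hlo]
  have hhi0 : hi 0 = fun i => ((F.P K).L : ℤ) * (sqHi (F.P K).L (cornerP (F.P K) Mc ρ a) (sideP (F.P K) Mc ρ) ρ (K - n) 1 i + 1) + (((F.P K).L : ℤ) - 1) := by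
    simp [hhi]
  have hloj : ∀ j', 1 ≤ j' → lo j' = sqLo (F.P K).L (cornerP (F.P K) Mc ρ a) ρ (K - n) j' - 1 := fun j' hj' => by
    simp [hlo, Nat.one_le_iff_ne_zero.mp hj']
  have hhij : ∀ j', 1 ≤ j' → hi j' = sqHi (F.P K).L (cornerP (F.P K) Mc ρ a) (sideP (F.P K) Mc ρ) ρ (K - n) j' + 1 := fun j' hj' => by
    simp [hhi, Nat.one_le_iff_ne_zero.mp hj']
  -- THE RECORD SIDE OF THE MEET: nesting, block saturation (grid numerics), the window's collar «π(□) ⊆ Ω_{K−n−1}» (57a), and `Adm22 D″ R (L·M_h)` (FILE D0)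
  have hnest : ∀ i : ℕ, 1 ≤ i → i < K - n → s.Ω (i + 1) ⊆ s.Ω i := fun i h1 hi => s.chain.Ω_succ_subset_Ω h1 (lt_of_lt_of_le hi hjk)
  have hdiv : ∀ j' : ℕ, 1 ≤ j' → j' ≤ K - n → dCubeSide (F.P K).L M (RkOfRecord (F.P K).L ν.r (g j')) j' ∣ (F.P K).sitesPerDir 0 :=
    fun j' h1 hj' => (hgrid j' h1 (hj'.trans hjk)).2
  have hgran : ∀ j' : ℕ, 1 ≤ j' → j' ≤ K - n → F.L * Mh ∣ M * RkOfRecord (F.P K).L ν.r (g j') := fun j' h1 hj' => (hgrid j' h1 (hj'.trans hjk)).1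
  have hsat : ∀ (j' : ℕ) (x x' : Site (F.P K) 0), 1 ≤ j' → j' ≤ K - n → iterBlockOf j' x = iterBlockOf j' x' → x ∈ s.Ω j' → x' ∈ s.Ω j' :=
    fun j' x x' h1 hj' => blockSat_seqOfRecord F ν M g K k (by have : (F.P K).m + (F.P K).K = F.m + K := rfl; omega) s (fun i h1 hi => (hgrid i h1 hi).2) j' x x' h1
      (hj'.trans hjk)
  have hν1 : 1 ≤ ν.M₁ := hM₁
  have hfloor : 11 * (F.P K).d + 2 * ρ + Mc + 3 ≤ ν.M₁ := by
    have hd : (F.P K).d = 4 := rfl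
    have hL1 : 1 ≤ F.L := by have := F.hL11; omega
    have : (11 * 4 + 4 * ρ + Mc + 3) ≤ (11 * 4 + 4 * ρ + Mc + 3) * F.L := Nat.le_mul_of_pos_right _ hL1
    rw [hd]; omega
  have hbox' : 2 ≤ K - n → ∀ z ∈ box (F.P K).L (cornerP (F.P K) Mc ρ a) (sideP (F.P K) Mc ρ) (K - n), cover (F.P K) z ∈ s.Ω (K - n - 1) :=
    fun h2 => cover_mem_Ω_pred_of_meet_box F ν M g K k s hν1 hsep hfloor h2 hjk hmeet
  have hLMh : 1 ≤ F.L * Mh := by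
    rw [hMha]
    exact Nat.one_le_iff_ne_zero.mpr (Nat.mul_ne_zero (by have := F.hL11; omega) (pow_ne_zero _ (by have := F.hL11; omega)))
  have hRsep : R * (F.L * Mh) + 1 ≤ (F.P K).L * ν.M₁ := by
    have hLP : (F.P K).L = F.L := rfl
    have hL1 : 1 ≤ F.L := by have := F.hL11; omega
    have h1 : ν.M₁ ≤ F.L * ν.M₁ := Nat.le_mul_of_pos_left _ hL1
    have h2 : ρ + 1 ≤ c := by
      have : (11 * 4 + 4 * ρ + Mc + 3) ≤ (11 * 4 + 4 * ρ + Mc + 3) * F.L := Nat.le_mul_of_pos_right _ hL1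
      omega
    rw [hLP]; omega
  have hAdmD := adm22_meetCube_trunc_seqOfRecord F ν M g K k s hjk hkP hLMh hν1 hRsep hsep hdiv hgran hdvd ha hM hper hRρ
  -- the chart side at this MEETING, CLEAN datum, at print's family, UNDER THE NORMALISED GAUGE: print's (154)–(159), no shear devices
  obtain ⟨HV, hHV, hch⟩ := hchart ν M g K k s hsep hM₁ hadm hk ε δ hδ hcompδ hcompδ' hε hεcomp hεcomp' W h7 U h17 h19 hfib hcrit hkkP hUW hcc n hkP hk1 hjk a hmeet
    hclean rfl lo hi hlo0 hhi0 hloj hhij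
  obtain ⟨xc, B, B', A₁, hxc, hX₁, hX₂, hB', h₁, h159⟩ := hch u A he heT hAT hAT2 hA hdA hcd hlap h6 hnrm
  -- FILE C at this datum AT ZERO SHEAR (`u_L := 1, U₁ := 1, λ := 0, X := 0, v := av := 0, σ := 0`, `t_D :=` the budget's slack), then the token's threshold exactly
  have hDσ : ∀ j' ≤ K - n, ((((F.P K).d * ((sideP (F.P K) Mc ρ + 4 * ρ + 3) * (F.P K).L ^ ((K - n) - j'))) : ℕ) : ℝ) * ((0 : ℝ) + 0) ≤ 0 :=
    fun _ _ => by simp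
  have hv : ∀ j' ≤ K - n, ∀ c' : PBond (F.P K) j', c'.src ∈ (castSite '' Set.Icc (lo j') (hi j') : Set (Site (F.P K) j')) →
      c'.tgt ∈ (castSite '' Set.Icc (lo j') (hi j') : Set (Site (F.P K) j')) →
        dist1 (Averaging.iter (avOfRecord F N K) j' (gaugeAct (fun _ => (1 : SU N)) (1 : GaugeField (F.P K) 0 (SU N))) c') ≤ (0 : ℝ) :=
    fun j' _ c' _ _ => dist1_iter_avOfRecord_gaugeAct_one F N K j' c'
  have hav : ∀ j' ≤ K - n, ∀ c' : PBond (F.P K) j', c'.src ∈ (castSite '' Set.Icc (lo j') (hi j') : Set (Site (F.P K) j')) →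
      c'.tgt ∈ (castSite '' Set.Icc (lo j') (hi j') : Set (Site (F.P K) j')) →
        dist1 (Averaging.iter (avOfRecord F N K) j' (1 : GaugeField (F.P K) 0 (SU N)) c') ≤ (0 : ℝ) :=
    fun j' _ c' _ _ => dist1_iter_avOfRecord_one F N K j' c'
  have hlam : ∀ (j' : ℕ) (y : Site (F.P K) j'), ‖(fun (_ : ℕ) (_ : Site (F.P K) j') => (0 : MatA N)) j' y‖ ≤
      ‖mlog (((((toMS (fun _ : Site (F.P K) 0 => (1 : SU N)) j' (castSite (lo j')))⁻¹ * toMS (fun _ : Site (F.P K) 0 => (1 : SU N)) j' y)⁻¹ : SU N)) : MatA N)‖ :=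
    fun _ _ => by rw [norm_zero]; exact norm_nonneg _
  have hX : ∀ c' : BondIdx (domainsMeet (cubeDomains (F.P K) (cornerP (F.P K) Mc ρ a) (sideP (F.P K) Mc ρ) ρ (K - n) hkP) (domainsOfSeq s.Ω (K - n) hkP)),
      (fun _ => (0 : MatA N)) c' = LatticeFieldCalculus.grad (((F.P K).L : ℝ) ^ (K - n) / ((F.P K).L : ℝ) ^ (c'.1.1 : ℕ))
        ((fun (_ : ℕ) (_ : Site (F.P K) _) => (0 : MatA N)) c'.1.1) c'.1.2 :=
    fun c' => (grad_zero_fun _ _).symm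
  have h159' : ∀ b, A b - HV (fun _ => (0 : MatA N)) b = A₁ b + HV B b - HV B' b := split159_of_zero_shear HV h159
  set tD : ℝ := C * δ (K - n) + θ * ε (K - n) + Q * ε (K - n) ^ 2 - (t₁ ε δ (K - n) + t₂ + t₃) with htD_def
  have htD : 2 * CS * BS * (4 * (0 : ℝ)) < tD := by
    have h0 : (0 : ℝ) < tD := sub_pos.mpr hsum
    simpa using h0
  have hclause := hmain n K hk1 (by omega) hkP hMha hMh hR (by omega) hM1 hLρ hinj s.Ω hnest hsat hbox' hAdmD hHV hxc hβ₁ hβ₂ h163 hX₁ hX₂ hs' hB'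
    hlo0 hhi0 hloj hhij (fun _ => (1 : SU N)) (1 : GaugeField (F.P K) 0 (SU N)) (fun _ => (0 : ℝ)) (fun _ => (0 : ℝ)) (fun _ => le_rfl) (fun _ => le_rfl)
    (by norm_num) hDσ hv hav (fun (_ : ℕ) (_ : Site (F.P K) _) => (0 : MatA N)) hlam hX u he hA hdA h₁ h159' ht₂ ht₃ htD
  exact hclause.of_le le_rfl (le_of_eq (by rw [htD_def]; ring))

end Summit.QuantumFields.YangMills.BalabanUVNodes.N07SplitClauseHeadKnitMeetNormalisedTowerW152EB

end
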